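import Summits.CriticalPhenomena.PercolationContinuityZ3.Theorems.PercNearOneGluingNoHeavyLowerTailSahiGridPatternStarLiteral

/-!
# `NoHeavyLowerTail` (crux stmt-CriticalPhenomena-4575), Sahi programme P1: **LITERAL PREFIXES OVER ANY CERTIFIED SLOT, and the
# two-orthant union in arbitrary position as a certified slot** (towards clause ∨ two monomials)

Support file (Sahi cell, seat `prim-sahi-p1`, generation 22; `--supports stmt-CriticalPhenomena-4575`).  Pure proofs, no definitions,
no `sorry`, standard axioms.  Vocabulary of `…SahiGridPattern{CellForm,DiagCert,PairCert,StarCertPrelim,TwoOrthantGeneral}`.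

RESULTS.  `litPrefix_cert`: if an up-set `U₀ ⊆ [3]^k` has a diagonal certificate, then for every `j` and thresholds `u : Fin j → {1,2}` the
up-set `{x ∈ [3]^{j+k} : (∃ i < j, u i ≤ x i) ∨ (x_{j..}) ∈ U₀}` — a clause of literals prefixed to `U₀` — has a diagonal certificate
(induction on `j` with `litOneAbsorb_cert` / `litTwoAbsorb_cert` and `diagCert_transfer`).  `twoOrthantPos_cert`: the union of two orthants on
disjoint supports `S₁, S₂ ⊆ Fin k` (thresholds nonzero on `S₁`, `S₁ ≠ ∅`, `S₁ ∪ S₂ = Fin k`) in ARBITRARY position has a diagonal certificate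
(the pair certificate of `…PairCert`, valid by `twoOrthant_hS_of_two/_of_ones`, moved along `exists_block_equiv`).  Consequence
(`sStarD_cylSet_clauseTwoOrthant_nonneg`): clause-prefixed two-orthant unions are good first slots in every dimension; general positions and the
value level (Kahn's `E₃ ≥ 0` for `A` = clause ∨ monomial ∨ monomial) are in the sequel.  Nothing here asserts `PatternPos d` for `d ≥ 4`. [this work]
-/

namespace Summit.CriticalPhenomena.PercolationContinuityZ3.Theorems.SahiGridPattern

open Finset SahiGrid3
open scoped BigOperators

/-! ### Literal prefixes over a certified slot -/

/-- **LITERAL PREFIX**: a clause of threshold-1/2 literals on fresh axes in front of ANY certified up-set is certified. [this work] -/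
theorem litPrefix_cert {k : ℕ} (U₀ : Finset (Pd k)) (hU₀ : IsUpperSet (U₀ : Set (Pd k))) (c₀ : Pd k → ℤ) (hc₀ : ∀ q, 0 ≤ c₀ q)
    (hT₀ : ∀ W : Finset (Pd k), IsUpperSet (W : Set (Pd k)) → (∑ q ∈ W, c₀ q) ≤ ∑ q ∈ W, lamU U₀ q)
    (hN₀ : ∀ A A' : Finset (Pd k), IsUpperSet (A : Set (Pd k)) → IsUpperSet (A' : Set (Pd k)) →
      (∑ q ∈ A, ∑ r ∈ A', thetaVal U₀ q r) ≤ ∑ q ∈ A ∩ A', c₀ q) :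
    ∀ (j : ℕ) (u : Fin j → Fin 3), (∀ i, u i ≠ 0) →
    ∃ c : Pd (j + k) → ℤ, (∀ q, 0 ≤ c q) ∧
      (∀ W : Finset (Pd (j + k)), IsUpperSet (W : Set (Pd (j + k))) → (∑ q ∈ W, c q) ≤ ∑ q ∈ W,
        lamU (univ.filter fun x : Pd (j + k) => (∃ i : Fin j, u i ≤ x (Fin.castAdd k i)) ∨ (fun a => x (Fin.natAdd j a)) ∈ U₀) q) ∧
      (∀ A A' : Finset (Pd (j + k)), IsUpperSet (A : Set (Pd (j + k))) → IsUpperSet (A' : Set (Pd (j + k))) →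
        (∑ q ∈ A, ∑ r ∈ A', thetaVal (univ.filter fun x : Pd (j + k) => (∃ i : Fin j, u i ≤ x (Fin.castAdd k i))
          ∨ (fun a => x (Fin.natAdd j a)) ∈ U₀) q r) ≤ ∑ q ∈ A ∩ A', c q) := by
  intro j
  induction j with
  | zero =>
    intro u _
    -- `[3]^{0+k}` is `[3]^k` re-indexed
    have hmem : ∀ p : Pd (0 + k), p ∈ (univ.filter fun x : Pd (0 + k) => (∃ i : Fin 0, u i ≤ x (Fin.castAdd k i))
        ∨ (fun a => x (Fin.natAdd 0 a)) ∈ U₀) ↔ (p ∘ (finCongr (Nat.zero_add k).symm)) ∈ U₀ := by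
      intro p
      rw [Finset.mem_filter]
      simp only [Finset.mem_univ, true_and, IsEmpty.exists_iff, false_or]
      have e : (fun a => p (Fin.natAdd 0 a)) = p ∘ (finCongr (Nat.zero_add k).symm) := by
        funext a; simp only [Function.comp_apply]; congr 1; ext; simp
      rw [e]
    obtain ⟨b1, b2, b3⟩ := diagCert_transfer (finCongr (Nat.zero_add k).symm) hmem c₀ hc₀ hT₀ hN₀
    exact ⟨_, b1, b2, b3⟩
  | succ j ih =>
    intro u hu
    set u' : Fin j → Fin 3 := fun i => u (Fin.succ i) with hu'def
    obtain ⟨c', hc', hT', hN'⟩ := ih u' (fun i => hu _)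
    set U' : Finset (Pd (j + k)) := univ.filter fun x : Pd (j + k) => (∃ i : Fin j, u' i ≤ x (Fin.castAdd k i))
      ∨ (fun a => x (Fin.natAdd j a)) ∈ U₀ with hU'
    have hU'up : IsUpperSet (U' : Set (Pd (j + k))) := by
      intro x y hxy hx
      rw [Finset.mem_coe, hU', Finset.mem_filter] at hx ⊢
      refine ⟨Finset.mem_univ _, ?_⟩
      rcases hx.2 with ⟨i, hle⟩ | h
      · exact Or.inl ⟨i, le_trans hle (hxy _)⟩
      · exact Or.inr (hU₀ (fun a => hxy _) h)
    set ℓ : Pd 1 := fun _ => u 0 with hℓ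
    set X : Finset (Pd (1 + (j + k))) := univ.filter fun y : Pd (1 + (j + k)) => u 0 ≤ y (Fin.castAdd (j + k) (0 : Fin 1)) with hXd
    set Y : Finset (Pd (1 + (j + k))) := univ.filter fun y : Pd (1 + (j + k)) => cellOf (n := 1) y ∈ U' with hYd
    have hX : ∀ (ξ : Pd 1) (z : Pd (j + k)), glue ξ z ∈ X ↔ ξ ∈ (univ.filter fun y : Pd 1 => ∀ jj, ℓ jj ≤ y jj) := by
      intro ξ z
      rw [hXd, Finset.mem_filter, Finset.mem_filter, glue_castAdd]
      simp only [Finset.mem_univ, true_and, Fin.forall_fin_one, hℓ]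
    have hY : ∀ (ξ : Pd 1) (z : Pd (j + k)), glue ξ z ∈ Y ↔ z ∈ U' := by
      intro ξ z; rw [hYd, Finset.mem_filter, cellOf_glue]; simp
    have hcert : ∃ c₁ : Pd (1 + (j + k)) → ℤ, (∀ x, 0 ≤ c₁ x) ∧
        (∀ W : Finset (Pd (1 + (j + k))), IsUpperSet (W : Set (Pd (1 + (j + k)))) → (∑ x ∈ W, c₁ x) ≤ ∑ x ∈ W, lamU (X ∪ Y) x) ∧
        (∀ A A' : Finset (Pd (1 + (j + k))), IsUpperSet (A : Set (Pd (1 + (j + k)))) → IsUpperSet (A' : Set (Pd (1 + (j + k)))) →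
          (∑ q ∈ A, ∑ r ∈ A', thetaVal (X ∪ Y) q r) ≤ ∑ x ∈ A ∩ A', c₁ x) := by
      have ht0 : u 0 ≠ 0 := hu 0
      by_cases h2 : u 0 = 2
      · have hℓ2 : ℓ 0 = 2 := by rw [hℓ]; exact h2
        obtain ⟨a1, a2, a3⟩ := litTwoAbsorb_cert ℓ hℓ2 hU'up c' hc' hT' hN' hX hY
        exact ⟨_, a1, a2, a3⟩
      · have h1 : u 0 = 1 := by
          have : ∀ v : Fin 3, v ≠ 0 → v ≠ 2 → v = 1 := by decide
          exact this _ ht0 h2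
        have hℓ1 : ∀ i, ℓ i = 1 := fun _ => by rw [hℓ]; exact h1
        obtain ⟨a1, a2, a3⟩ := litOneAbsorb_cert ℓ hℓ1 hU'up hX hY
        exact ⟨_, a1, a2, a3⟩
    obtain ⟨c₁, hc₁, hT₁, hN₁⟩ := hcert
    -- transfer along `Fin (1 + (j+k)) ≃ Fin (j+1+k)`
    have hjk : j + 1 + k = 1 + (j + k) := by omega
    have hmem : ∀ p : Pd (j + 1 + k), p ∈ (univ.filter fun x : Pd (j + 1 + k) => (∃ i : Fin (j + 1), u i ≤ x (Fin.castAdd k i))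
        ∨ (fun a => x (Fin.natAdd (j + 1) a)) ∈ U₀) ↔ (p ∘ (finCongr hjk.symm)) ∈ X ∪ Y := by
      intro p
      have e0 : (p ∘ (finCongr hjk.symm)) (Fin.castAdd (j + k) (0 : Fin 1)) = p (Fin.castAdd k 0) := by
        simp only [Function.comp_apply]; congr 1
      have e1 : ∀ i : Fin j, cellOf (n := 1) (p ∘ (finCongr hjk.symm)) (Fin.castAdd k i) = p (Fin.castAdd k (Fin.succ i)) := by
        intro i; simp only [cellOf, Function.comp_apply]; congr 1; ext; simp [Nat.add_comm]
      have e2 : (fun a => cellOf (n := 1) (p ∘ (finCongr hjk.symm)) (Fin.natAdd j a)) = fun a => p (Fin.natAdd (j + 1) a) := by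
        funext a; simp only [cellOf, Function.comp_apply]; congr 1; ext; simp; omega
      rw [Finset.mem_union, hXd, hYd, Finset.mem_filter, Finset.mem_filter, Finset.mem_filter, e0, hU', Finset.mem_filter, e2]
      simp only [Finset.mem_univ, true_and, e1, hu'def]
      constructor
      · rintro (⟨i, hle⟩ | h)
        · refine Fin.cases ?_ (fun i' => ?_) i hle
          · intro hle; exact Or.inl hle
          · intro hle; exact Or.inr (Or.inl ⟨i', hle⟩)
        · exact Or.inr (Or.inr h)
      · rintro (hle | ⟨i', hle⟩ | h)
        · exact Or.inl ⟨0, hle⟩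
        · exact Or.inl ⟨Fin.succ i', hle⟩
        · exact Or.inr h
    obtain ⟨b1, b2, b3⟩ := diagCert_transfer (finCongr hjk.symm) hmem c₁ hc₁ hT₁ hN₁
    exact ⟨_, b1, b2, b3⟩

/-! ### The two-orthant union as a certified slot, and clause ∨ monomial ∨ monomial in block form -/

/-- **The pair certificate of a union of two orthants with disjoint supports is a diagonal certificate** (block form: `↑a × [3]^k ∪ [3]^n × ↑b`,
`a ∈ {1,2}^n`, `n ≥ 1`, any `b`; (N) by `twoOrthant_hS_of_two` / `twoOrthant_hS_of_ones`). [this work] -/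
theorem twoOrthantBlock_cert {n k : ℕ} (a : Pd n) (ha : (∃ i, a i = 2) ∨ (∀ i, a i = 1)) (hn : 0 < n) (b : Pd k)
    {X Y : Finset (Pd (n + k))} (hX : ∀ ξ q, glue ξ q ∈ X ↔ ξ ∈ (univ.filter fun x : Pd n => ∀ i, a i ≤ x i))
    (hY : ∀ ξ q, glue ξ q ∈ Y ↔ q ∈ (univ.filter fun x : Pd k => ∀ j, b j ≤ x j)) :
    (∀ x : Pd (n + k), 0 ≤ (2:ℤ) ^ (n + k) * (ind X x + ind Y x) - ind X x * ((nuCount (X ∪ Y) x : ℤ) - nuCount X x)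
        - ind X x * ind Y x * (nuCount X x : ℤ)) ∧
    (∀ W : Finset (Pd (n + k)), IsUpperSet (W : Set (Pd (n + k))) →
      (∑ x ∈ W, ((2:ℤ) ^ (n + k) * (ind X x + ind Y x) - ind X x * ((nuCount (X ∪ Y) x : ℤ) - nuCount X x)
        - ind X x * ind Y x * (nuCount X x : ℤ))) ≤ ∑ x ∈ W, lamU (X ∪ Y) x) ∧
    (∀ A A' : Finset (Pd (n + k)), IsUpperSet (A : Set (Pd (n + k))) → IsUpperSet (A' : Set (Pd (n + k))) →
      (∑ q ∈ A, ∑ r ∈ A', thetaVal (X ∪ Y) q r) ≤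
        ∑ x ∈ A ∩ A', ((2:ℤ) ^ (n + k) * (ind X x + ind Y x) - ind X x * ((nuCount (X ∪ Y) x : ℤ) - nuCount X x)
          - ind X x * ind Y x * (nuCount X x : ℤ))) := by
  have hS := (show _ from
    match ha with
    | Or.inl h2 => twoOrthant_hS_of_two a h2 b hX hY
    | Or.inr h1 => twoOrthant_hS_of_ones a h1 hn b hX hY)
  exact ⟨fun x => pairCert_nonneg X Y x, fun W hW => pairCert_T hX hY (isUpperSet_filter_le a) (isUpperSet_filter_le b) W hW,
    pairCert_N_of_sStarD_ge hX hY hS⟩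

/-- **CLAUSE ∨ MONOMIAL ∨ MONOMIAL in block form is a good first slot in every dimension**: for literal thresholds `u : Fin j → {1,2}`, an orthant
`↑a` (`a ∈ {1,2}^n`, `n ≥ 1`) and an orthant `↑b` (any `b ∈ [3]^k`) on consecutive disjoint blocks of axes,
`{x ∈ [3]^{j+(n+k)} : (∃ i < j, u i ≤ x i) ∨ (a ≤ x|_{block 2}) ∨ (b ≤ x|_{block 3})} × [3]^m` is good for all `m`. [this work] -/
theorem sStarD_cylSet_clauseTwoOrthant_nonneg {m j n k : ℕ} (u : Fin j → Fin 3) (hu : ∀ i, u i ≠ 0)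
    (a : Pd n) (ha : (∃ i, a i = 2) ∨ (∀ i, a i = 1)) (hn : 0 < n) (b : Pd k)
    {B C : Finset (Pd (m + (j + (n + k))))} (hB : IsUpperSet (B : Set (Pd (m + (j + (n + k))))))
    (hC : IsUpperSet (C : Set (Pd (m + (j + (n + k)))))) :
    0 ≤ sStarD (cylSet (univ.filter fun x : Pd (j + (n + k)) => (∃ i : Fin j, u i ≤ x (Fin.castAdd (n + k) i))
        ∨ (fun c => x (Fin.natAdd j c)) ∈ ((univ.filter fun y : Pd (n + k) => ∀ i, a i ≤ y (Fin.castAdd k i))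
            ∪ (univ.filter fun y : Pd (n + k) => ∀ i, b i ≤ y (Fin.natAdd n i)))) : Finset (Pd (m + (j + (n + k))))) B C := by
  set X : Finset (Pd (n + k)) := univ.filter fun y : Pd (n + k) => ∀ i, a i ≤ y (Fin.castAdd k i) with hXd
  set Y : Finset (Pd (n + k)) := univ.filter fun y : Pd (n + k) => ∀ i, b i ≤ y (Fin.natAdd n i) with hYd
  have hX : ∀ (ξ : Pd n) (q : Pd k), glue ξ q ∈ X ↔ ξ ∈ (univ.filter fun x : Pd n => ∀ i, a i ≤ x i) := by
    intro ξ q; rw [hXd, Finset.mem_filter, Finset.mem_filter]; simp only [Finset.mem_univ, true_and, glue_castAdd]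
  have hY : ∀ (ξ : Pd n) (q : Pd k), glue ξ q ∈ Y ↔ q ∈ (univ.filter fun x : Pd k => ∀ j, b j ≤ x j) := by
    intro ξ q; rw [hYd, Finset.mem_filter, Finset.mem_filter]; simp only [Finset.mem_univ, true_and, glue_natAdd]
  have hU₀ : IsUpperSet ((X ∪ Y : Finset (Pd (n + k))) : Set (Pd (n + k))) := by
    rw [Finset.coe_union]
    refine IsUpperSet.union ?_ ?_
    · intro x y hxy hx
      rw [Finset.mem_coe, hXd, Finset.mem_filter] at hx ⊢
      exact ⟨Finset.mem_univ _, fun i => le_trans (hx.2 i) (hxy _)⟩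
    · intro x y hxy hx
      rw [Finset.mem_coe, hYd, Finset.mem_filter] at hx ⊢
      exact ⟨Finset.mem_univ _, fun i => le_trans (hx.2 i) (hxy _)⟩
  obtain ⟨h1, h2, h3⟩ := twoOrthantBlock_cert a ha hn b hX hY
  obtain ⟨c, hc, hT, hN⟩ := litPrefix_cert (X ∪ Y) hU₀ _ h1 h2 h3 j u hu
  exact sStarD_cylSet_nonneg_of_diagCert _ c hc hT hN hB hC

end Summit.CriticalPhenomena.PercolationContinuityZ3.Theorems.SahiGridPattern
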